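import Mathlib.RingTheory.Unramified.LocalStructure
import Mathlib.RingTheory.Etale.Locus
import Mathlib.RingTheory.TensorProduct.MvPolynomial
import Mathlib.RingTheory.TensorProduct.Quotient
import Mathlib.RingTheory.Localization.BaseChange
import Mathlib.RingTheory.Localization.LocalizationLocalization
import Mathlib.RingTheory.FinitePresentation
import HarnessLib

/-!
# Étale algebras over a localisation come from étale algebras over the ring, up to
localisation at a prime

Topic: `Literature/AlgebraicGeometry/Resolution` (infrastructure for the scheme-level assembly
of the named fact `DeJong1996FormalNormalCrossings`, `AlterationsNormalFormBlowup.lean`: an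
étale algebra over the LOCAL RING `𝒪_{X,x}` produced by local algebra — the étale splitting of
`FormalBranchesSplitting.lean` — has to be realised by an étale neighbourhood of `x` in `X`).
Everything here is PROVED; no definitions of notions, no named facts.

**Theorem** (`exists_etale_spread`). Let `A` be the localisation of a ring `R₀` at a submonoid
`M`, `R'` an étale `A`-algebra (with compatible `R₀`-algebra structure) and `P` a prime of `R'`.
Then there are an étale `R₀`-algebra `E` and a prime `Q` of `E` over the same prime of `R₀` as
`P` such that `E_Q ≅ R'_P` as `R₀`-algebras.

Proof (the affine content of EGA IV₄ 17.7.8 / Stacks 00U2 + 00QN for this special case):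

* `exists_map_eq_smul` — clearing denominators: every `p ∈ A[X₁, …, X_n]` is `b⁻¹ p₀` with
  `b ∈ M`, `p₀ ∈ R₀[X]` (Mathlib `IsLocalization.exist_integer_multiples`);
* `DescAlg`, `descHom`, `descBaseChange`, `isLocalization_descHom` — from a finite presentation
  `R' = A[X]/(q₁, …, q_m)` (Mathlib: étale ⇒ finitely presented) descend to
  `S₀ = R₀[X]/(q₀ⱼ)`, `q₀ⱼ = bⱼ qⱼ`; then `A ⊗_{R₀} S₀ ≅ A[X]/(bⱼqⱼ) = A[X]/(qⱼ) ≅ R'`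
  (Mathlib `MvPolynomial.algebraTensorAlgEquiv`, `Algebra.TensorProduct.tensorQuotientEquiv`),
  so `R'` IS the localisation `M⁻¹S₀` (Mathlib `IsLocalization.tensorRight`);
* `S₀` is étale at `P₀ = P ∩ S₀`: `(S₀)_{P₀} = R'_P` (localisation of a localisation) is
  formally étale over `A`, which is formally étale over `R₀`; a basic open `E = S₀[1/g] ∌ P₀` is
  then (standard) étale over `R₀` (Mathlib `Algebra.IsEtaleAt.exists_isStandardEtale`), and
  `E_Q = (S₀)_{P₀} = R'_P` for `Q = P₀E`.

## Sources

* A. Grothendieck, EGA IV₄ (Publ. Math. IHÉS 32, 1967), Prop. 17.7.8, 18.1.1. [EGAIV4]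
* The Stacks Project, Tag 00U2 (étale ring maps), Tag 00QN (finite presentation and limits),
  Tag 00UE (standard étale). [StacksProject]
-/

noncomputable section

open TensorProduct

namespace Literature.AlgebraicGeometry.Resolution

universe u

/-! ## Descending polynomials along a localisation -/

section Descend

variable {R₀ : Type u} [CommRing R₀] (M : Submonoid R₀) {A : Type u} [CommRing A] [Algebra R₀ A]
  [IsLocalization M A] {σ : Type*}

/-- **Clearing denominators in a polynomial over a localisation**: for `p ∈ A[X]`,
`A = M⁻¹R₀`, there are `b ∈ M` and `p₀ ∈ R₀[X]` with `p₀ = b·p` in `A[X]`. [folklore] -/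
theorem exists_map_eq_smul (p : MvPolynomial σ A) :
    ∃ (b : M) (p₀ : MvPolynomial σ R₀), MvPolynomial.map (algebraMap R₀ A) p₀ = (b : R₀) • p := by
  classical
  obtain ⟨b, hb⟩ := IsLocalization.exist_integer_multiples M p.support fun m => p.coeff m
  have hc : ∀ m, ∃ c : R₀, m ∈ p.support → algebraMap R₀ A c = (b : R₀) • p.coeff m := by
    intro m
    by_cases hm : m ∈ p.support
    · obtain ⟨c, hc⟩ := hb m hm
      exact ⟨c, fun _ => hc⟩
    · exact ⟨0, fun h => absurd h hm⟩
  choose c hc using hc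
  refine ⟨b, ∑ m ∈ p.support, MvPolynomial.monomial m (c m), ?_⟩
  rw [map_sum]
  conv_rhs => rw [← MvPolynomial.support_sum_monomial_coeff p, Finset.smul_sum]
  refine Finset.sum_congr rfl fun m hm => ?_
  rw [MvPolynomial.map_monomial, hc m hm, MvPolynomial.smul_monomial]

end Descend

/-! ## A finite presentation over the localisation comes from one over the ring, of which the
given algebra is a localisation -/

section Presentation

variable {R₀ : Type u} [CommRing R₀] (M : Submonoid R₀) {A : Type u} [CommRing A] [Algebra R₀ A]
  [IsLocalization M A]
variable {R' : Type u} [CommRing R'] [Algebra A R'] [Algebra R₀ R'] [IsScalarTower R₀ A R']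
variable {n m : ℕ} (f : MvPolynomial (Fin n) A →ₐ[A] R') (hf : Function.Surjective f)
  (q : Fin m → MvPolynomial (Fin n) A) (hq : Ideal.span (Set.range q) = RingHom.ker f)
  (b : Fin m → M) (q₀ : Fin m → MvPolynomial (Fin n) R₀)
  (hq₀ : ∀ j, MvPolynomial.map (algebraMap R₀ A) (q₀ j) = ((b j : M) : R₀) • q j)

/-- The descended ideal of relations `I₀ = (q₀ⱼ) ⊆ R₀[X]`. [folklore] -/
def descIdeal : Ideal (MvPolynomial (Fin n) R₀) := Ideal.span (Set.range q₀)

/-- The descended algebra `S₀ = R₀[X]/I₀`. [folklore] -/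
abbrev DescAlg : Type u := MvPolynomial (Fin n) R₀ ⧸ descIdeal q₀

omit [Algebra R₀ R'] [IsScalarTower R₀ A R'] in
include hq hq₀ in
/-- `I₀·A[X] = ker f` (the `bⱼ` are units of `A`). [folklore] -/
theorem map_descIdeal :
    (descIdeal q₀).map (MvPolynomial.map (algebraMap R₀ A)) = RingHom.ker f := by
  rw [descIdeal, Ideal.map_span, ← Set.range_comp, ← hq]
  apply le_antisymm
  · rw [Ideal.span_le]
    rintro _ ⟨j, rfl⟩
    rw [SetLike.mem_coe, Function.comp_apply, hq₀]
    exact Submodule.smul_of_tower_mem _ _ (Ideal.subset_span ⟨j, rfl⟩)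
  · rw [Ideal.span_le]
    rintro _ ⟨j, rfl⟩
    have hu : IsUnit (algebraMap R₀ A (b j)) := IsLocalization.map_units A (b j)
    have : q j = (↑hu.unit⁻¹ : A) • (MvPolynomial.map (algebraMap R₀ A) ∘ q₀) j := by
      rw [Function.comp_apply, hq₀, ← IsScalarTower.algebraMap_smul A (b j : R₀) (q j), smul_smul,
        IsUnit.val_inv_mul, one_smul]
    rw [SetLike.mem_coe, this]
    exact Submodule.smul_of_tower_mem _ _
      (Ideal.subset_span (Set.mem_range_self (f := MvPolynomial.map (algebraMap R₀ A) ∘ q₀) j))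


/-- The comparison map `φ : S₀ → R'`, `p̄₀ ↦ f(p₀)`. [folklore] -/
def descHom : DescAlg q₀ →ₐ[R₀] R' :=
  Ideal.Quotient.liftₐ (descIdeal q₀)
    ((f.restrictScalars R₀).comp (MvPolynomial.mapAlgHom (Algebra.ofId R₀ A))) (by
      intro p hp
      change f (MvPolynomial.map (algebraMap R₀ A) p) = 0
      rw [← RingHom.mem_ker]
      have : (descIdeal q₀).map (MvPolynomial.map (algebraMap R₀ A)) ≤ RingHom.ker f := by
        rw [map_descIdeal M f q hq b q₀ hq₀]
      exact this (Ideal.mem_map_of_mem _ hp))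

/-- `φ (p̄₀) = f (p₀)`. [folklore] -/
theorem descHom_mk (p : MvPolynomial (Fin n) R₀) :
    descHom M f q hq b q₀ hq₀ (Ideal.Quotient.mk _ p) = f (MvPolynomial.map (algebraMap R₀ A) p) :=
  rfl

omit [Algebra R₀ R'] [IsScalarTower R₀ A R'] in
include hq hq₀ in
/-- The image in `A[X]` of the extension of `I₀` to `A ⊗ R₀[X]` is `ker f`. [folklore] -/
theorem map_map_descIdeal :
    ((descIdeal q₀).map (Algebra.TensorProduct.includeRight (R := R₀) (A := A))).map
        (MvPolynomial.algebraTensorAlgEquiv (σ := Fin n) R₀ A :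
          A ⊗[R₀] MvPolynomial (Fin n) R₀ →+* MvPolynomial (Fin n) A) = RingHom.ker f := by
  change ((descIdeal q₀).map (Algebra.TensorProduct.includeRight (R := R₀) (A := A)).toRingHom).map
    (MvPolynomial.algebraTensorAlgEquiv (σ := Fin n) R₀ A).toRingEquiv.toRingHom = RingHom.ker f
  rw [Ideal.map_map, ← map_descIdeal M f q hq b q₀ hq₀]
  congr 1
  ext p
  · simp [MvPolynomial.algebraTensorAlgEquiv_tmul]
  · simp [MvPolynomial.algebraTensorAlgEquiv_tmul]

/-- **`A ⊗_{R₀} S₀ ≅ R'`**: base change of the descended presentation recovers the given one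
(`A ⊗ R₀[X]/I₀ ≅ (A ⊗ R₀[X])/I₀ ≅ A[X]/I₀A[X] = A[X]/ker f ≅ R'`). [folklore] -/
def descBaseChange : A ⊗[R₀] DescAlg q₀ ≃ₐ[A] R' :=
  (Algebra.TensorProduct.tensorQuotientEquiv A (MvPolynomial (Fin n) R₀) A (descIdeal q₀)).trans
    ((Ideal.quotientEquivAlg _ _ (MvPolynomial.algebraTensorAlgEquiv (σ := Fin n) R₀ A)
      (map_map_descIdeal M f q hq b q₀ hq₀).symm).trans
      (Ideal.quotientKerAlgEquivOfSurjective hf))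

omit [Algebra R₀ R'] [IsScalarTower R₀ A R'] in
/-- `Ξ (a ⊗ p̄₀) = a · f(p₀)`. [folklore] -/
theorem descBaseChange_tmul (a : A) (p : MvPolynomial (Fin n) R₀) :
    descBaseChange M f hf q hq b q₀ hq₀ (a ⊗ₜ Ideal.Quotient.mk _ p) =
      a • f (MvPolynomial.map (algebraMap R₀ A) p) := by
  rw [descBaseChange, AlgEquiv.trans_apply, AlgEquiv.trans_apply]
  change Ideal.quotientKerAlgEquivOfSurjective hf (Ideal.quotientEquivAlg _ _
    (MvPolynomial.algebraTensorAlgEquiv (σ := Fin n) R₀ A) (map_map_descIdeal M f q hq b q₀ hq₀).symm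
      (Ideal.Quotient.mk _ (a ⊗ₜ p))) = _
  rw [Ideal.quotientEquivAlg_mk, MvPolynomial.algebraTensorAlgEquiv_tmul,
    Ideal.quotientKerAlgEquivOfSurjective_mk, map_smul]

/-- In particular `Ξ (1 ⊗ z) = φ z`. [folklore] -/
theorem descBaseChange_one_tmul (z : DescAlg q₀) :
    descBaseChange M f hf q hq b q₀ hq₀ (1 ⊗ₜ z) = descHom M f q hq b q₀ hq₀ z := by
  obtain ⟨p, rfl⟩ := Ideal.Quotient.mk_surjective z
  rw [descBaseChange_tmul, one_smul, descHom_mk]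

include hf in
/-- **`R'` is the localisation of `S₀` at `M`** (through `φ`): `A ⊗_{R₀} S₀` is (Mathlib
`IsLocalization.tensorRight`) and `Ξ` is an `S₀`-isomorphism. [folklore] -/
theorem isLocalization_descHom :
    @IsLocalization _ _ (Algebra.algebraMapSubmonoid (DescAlg q₀) M) R' _
      (descHom M f q hq b q₀ hq₀).toRingHom.toAlgebra := by
  letI : Algebra (DescAlg q₀) R' := (descHom M f q hq b q₀ hq₀).toRingHom.toAlgebra
  letI : Algebra (DescAlg q₀) (A ⊗[R₀] DescAlg q₀) := Algebra.TensorProduct.rightAlgebra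
  haveI : IsLocalization (Algebra.algebraMapSubmonoid (DescAlg q₀) M) (A ⊗[R₀] DescAlg q₀) :=
    inferInstance
  let Ξ : A ⊗[R₀] DescAlg q₀ ≃ₐ[DescAlg q₀] R' :=
    AlgEquiv.ofRingEquiv (f := (descBaseChange M f hf q hq b q₀ hq₀).toRingEquiv) fun z => by
      change descBaseChange M f hf q hq b q₀ hq₀ (algebraMap (DescAlg q₀) (A ⊗[R₀] DescAlg q₀) z) =
        descHom M f q hq b q₀ hq₀ z
      rw [Algebra.TensorProduct.right_algebraMap_apply, descBaseChange_one_tmul]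
  exact IsLocalization.isLocalization_of_algEquiv (S := A ⊗[R₀] DescAlg q₀) (P := R')
    (Algebra.algebraMapSubmonoid (DescAlg q₀) M) Ξ

end Presentation

/-! ## The theorem -/

/-- **Étale algebras over a localisation spread out, up to localisation at a prime.** Let `A`
be the localisation of a ring `R₀` at a submonoid `M` (e.g. the local ring `(R₀)_𝔭` of a
point), `R'` an étale `A`-algebra and `P` a prime of `R'`. Then there are an étale `R₀`-algebra
`E` and a prime `Q` of `E`, over the same prime of `R₀` as `P`, with `E_Q ≅ R'_P` as
`R₀`-algebras. (Descend a finite presentation `R' = A[X]/(q)` to `S₀ = R₀[X]/(q₀)` by clearing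
denominators, so that `R' = M⁻¹S₀`; `S₀` is étale at `P₀ = P ∩ S₀` since `(S₀)_{P₀} = R'_P` is
formally étale over `A`, hence over `R₀`; a basic open neighbourhood `E = S₀[1/g]` of `P₀` is
(standard) étale over `R₀`, Mathlib `Algebra.IsEtaleAt.exists_isStandardEtale`; and
`E_Q = (S₀)_{P₀} = R'_P`.) This is the affine algebra behind "an étale neighbourhood of
`Spec 𝒪_{X,x}` comes from an étale neighbourhood of `x` in `X`" (EGA IV₄ 17.7.8, 18.1.1; Stacks,
Tag 00U2 with Tag 00QN). [cite: StacksProject, Tag 00UE and Tag 00QN] -/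
theorem exists_etale_spread {R₀ : Type u} [CommRing R₀] (M : Submonoid R₀) {A : Type u} [CommRing A]
    [Algebra R₀ A] [IsLocalization M A] {R' : Type u} [CommRing R'] [Algebra A R'] [Algebra R₀ R']
    [IsScalarTower R₀ A R'] [Algebra.Etale A R'] (P : Ideal R') [P.IsPrime] :
    ∃ (E : Type u) (_ : CommRing E) (_ : Algebra R₀ E) (_ : Algebra.Etale R₀ E) (Q : Ideal E)
      (_ : Q.IsPrime), Q.under R₀ = P.under R₀ ∧
        Nonempty (Localization.AtPrime Q ≃ₐ[R₀] Localization.AtPrime P) := by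
  classical
  /- a finite presentation of `R'` over `A` -/
  obtain ⟨n, f, hf⟩ := Algebra.FiniteType.iff_quotient_mvPolynomial''.1
    (inferInstance : Algebra.FiniteType A R')
  have hker : (RingHom.ker f.toRingHom).FG := Algebra.FinitePresentation.ker_fG_of_surjective f hf
  obtain ⟨m, q, hq⟩ := Submodule.fg_iff_exists_fin_generating_family.mp hker
  change Ideal.span (Set.range q) = RingHom.ker f at hq
  /- descend it -/
  choose b q₀ hq₀ using fun j => exists_map_eq_smul M (q j)
  let S₀ : Type u := DescAlg q₀
  let φ : S₀ →ₐ[R₀] R' := descHom M f q hq b q₀ hq₀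
  letI : Algebra S₀ R' := φ.toRingHom.toAlgebra
  haveI : IsScalarTower R₀ S₀ R' := IsScalarTower.of_algebraMap_eq fun r => (φ.commutes r).symm
  haveI : IsLocalization (Algebra.algebraMapSubmonoid S₀ M) R' :=
    isLocalization_descHom M f hf q hq b q₀ hq₀
  haveI : Algebra.FinitePresentation R₀ S₀ :=
    Algebra.FinitePresentation.quotient (Submodule.fg_span (Set.finite_range q₀))
  /- the prime `P₀ = P ∩ S₀`; `R'_P` is the localisation of `S₀` at `P₀` -/
  let P₀ : Ideal S₀ := P.comap (algebraMap S₀ R')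
  haveI : P₀.IsPrime := Ideal.comap_isPrime _ P
  haveI : IsLocalization.AtPrime (Localization.AtPrime P) P₀ :=
    IsLocalization.isLocalization_isLocalization_atPrime_isLocalization
      (Algebra.algebraMapSubmonoid S₀ M) (Localization.AtPrime P) P
  /- `S₀` is étale at `P₀` -/
  haveI : Algebra.IsEtaleAt R₀ P₀ := by
    have h1 : Algebra.FormallyEtale R₀ (Localization.AtPrime P) := by
      haveI : Algebra.FormallyEtale R₀ A := .of_isLocalization M
      haveI : Algebra.FormallyEtale R₀ R' := .comp R₀ A R'
      haveI : Algebra.FormallyEtale R' (Localization.AtPrime P) := .of_isLocalization P.primeCompl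
      exact .comp R₀ R' _
    let ε : Localization.AtPrime P ≃ₐ[S₀] Localization.AtPrime P₀ :=
      (IsLocalization.algEquiv P₀.primeCompl (Localization.AtPrime P₀) (Localization.AtPrime P)).symm
    exact Algebra.FormallyEtale.of_equiv (ε.restrictScalars R₀)
  /- a standard étale basic open neighbourhood of `P₀` -/
  obtain ⟨g₁, hg₁, hstd⟩ := Algebra.IsEtaleAt.exists_isStandardEtale (R := R₀) P₀
  haveI := hstd
  let E : Type u := Localization.Away g₁
  have hdisj : Disjoint (↑(Submonoid.powers g₁) : Set S₀) ↑P₀ :=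
    (Ideal.disjoint_powers_iff_notMem g₁ (Ideal.IsPrime.isRadical ‹_›)).mpr hg₁
  let Q : Ideal E := P₀.map (algebraMap S₀ E)
  haveI hQp : Q.IsPrime := IsLocalization.isPrime_of_isPrime_disjoint (Submonoid.powers g₁) E P₀ ‹_› hdisj
  have hQ : Q.comap (algebraMap S₀ E) = P₀ :=
    IsLocalization.under_map_of_isPrime_disjoint (Submonoid.powers g₁) E ‹P₀.IsPrime› hdisj
  haveI : IsLocalization.AtPrime (Localization.AtPrime Q) P₀ := by
    have h := IsLocalization.isLocalization_isLocalization_atPrime_isLocalization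
      (Submonoid.powers g₁) (Localization.AtPrime Q) Q
    have hQ' : Q.comap (algebraMap S₀ E) = P₀ := hQ
    -- transport the `IsLocalization.AtPrime` statement along `hQ'`
    unfold IsLocalization.AtPrime at h ⊢
    have hc : (Q.comap (algebraMap S₀ E)).primeCompl = P₀.primeCompl := by
      ext z
      change z ∉ Q.comap (algebraMap S₀ E) ↔ z ∉ P₀
      rw [hQ']
    rwa [hc] at h
  let ι : Localization.AtPrime Q ≃ₐ[S₀] Localization.AtPrime P :=
    IsLocalization.algEquiv P₀.primeCompl _ _
  refine ⟨E, inferInstance, inferInstance, inferInstance, Q, hQp, ?_, ⟨ι.restrictScalars R₀⟩⟩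
  /- `Q` and `P` lie over the same prime of `R₀` -/
  calc Q.under R₀ = (Q.comap (algebraMap S₀ E)).comap (algebraMap R₀ S₀) := by
        rw [Ideal.under_def, Ideal.comap_comap, ← IsScalarTower.algebraMap_eq]
    _ = (P.comap (algebraMap S₀ R')).comap (algebraMap R₀ S₀) := by rw [hQ]
    _ = P.under R₀ := by
        rw [Ideal.under_def, Ideal.comap_comap, ← IsScalarTower.algebraMap_eq]

end Literature.AlgebraicGeometry.Resolution

end
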